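import Summits.BirchSwinnertonDyer.BirchSwinnertonDyer.Theorems.SignedLowerHalvesSmallImageLowerHalfBothSignsRttJunctionShaLayerMaps
import Literature.NumberTheory.ComplexMultiplication.EllipticUnits.CoinducedPairingAdjointSums
import HarnessLib

/-!
# Route `SignedLowerHalves`, crux L `SmallImageLowerHalfBothSigns` (stmt-BirchSwinnertonDyer-23599), line `rtt_w3` v33 — stub S3α″ (`stub_junctionShaPi_ns`),
# brick α5′-2b: NATURALITY of the layer Poitou–Tate pairing `pairO` — corestriction ⊣ restriction, reduction ⊣ inclusion, `conj_γ ⊣ conj_{γ⁻¹}`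

INPUTS hand `bsd-inputs-honda-p1` g29 under LEAD `cruxlead-stmt-BirchSwinnertonDyer-23599` (cell `bsd-ssimc`); helper `--supports stmt-BirchSwinnertonDyer-23599`.
THEOREMS ONLY (no definition, no named fact, no instance, no `sorry`). The one-variable `𝒪`-coefficient twin of the tree's IMC template
`Literature/…/EllipticUnits/ImaginaryQuadraticMainConjectureLayerDualityNaturality.lean`: everything is read off clause (N_V) of the engine
`PoitouTateShaRestrictedLayers.exists_shaRestricted_pairing_coind_of_natural_at` at the three adjoint pairs of module maps (`CoinducedPairingAdjointSums`), transported to honda's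
currency by the generic Shapiro dictionary (`ShaLayer.layerShapiroEquiv_transport_coindFinSum / _coindFinRes / _coindFinMap / _rTransHom_one / _two`) and the `𝒪`-carrier
identifications (`relCoresO_eq_relCor`, `cohomologyMap_muTwistORedHom_eq_cycLayerRedO`, `layerConj_toUnramifiedQuot`). Abstract discrete module `A`, abstract pairings `B k`.

* §1 `coe_eTwoO_symm_eq`, `coe_eOneO_symm_eq`, `transport_eTwoO_symm`, `transport_eOneO_symm` — identification of `e⁻¹` of a structure-mapped class;
* §2 ★ `pairO_cores` — `⟨cor y, z⟩_n = ⟨y, res z⟩_{n+1}`;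
* §3 ★ `pairO_red` — `⟨red y, z⟩_k = ⟨y, incl z⟩_{k+1}`, under the displayed level law `hBred` of the pairings (`muVal (B k (red x) m) = muVal (B (k+1) x (incl m))`;
  for `A = Cofree θ F` it is -w3's `muInclusion_cofreeLamPairing_oMuRed`);
* §4 ★ `pairO_conj` — `⟨conj_γ y, z⟩ = ⟨y, conj_{γ⁻¹} z⟩`.
HONEST FRAMING: bookkeeping; α5′, S3α″, crux L and BSD are NOT proved here and remain OPEN; BSD is proved for NO curve.
References: [MilneADT2006] I §4 p. 65, I Thm. 4.10 (a); [NeukirchSchmidtWingberg2008] I §5 Prop. (1.5.3)(iv), I §6 (1.6.4)–(1.6.5); [SerreLocalFields1979] VII §5;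
[Kato2004Asterisque] §8.2 (p. 180); [JohnsonLeungKings2011] §5.4 Lemma 5.8.
-/

set_option autoImplicit false
set_option linter.dupNamespace false -- D-0017: single-problem summit, the namespace repeats the problem name by design
noncomputable section

open scoped Classical
open NumberField IsDedekindDomain Field Function CategoryTheory

namespace Summit.BirchSwinnertonDyer.BirchSwinnertonDyer.Theorems.SmallImageRttJunctionSha

open Literature.NumberTheory.EllipticCurves Literature.NumberTheory.GaloisRepresentations
  Literature.NumberTheory.GaloisRepresentations.DiscreteGaloisModule Literature.NumberTheory.GaloisCohomology Literature.NumberTheory.GaloisCohomology.ShaLayer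
  Literature.NumberTheory.ComplexMultiplication.EllipticUnits Literature.NumberTheory.ComplexMultiplication.EllipticUnits.JohnsonLeungKings2011
  Literature.NumberTheory.ComplexMultiplication.EllipticUnits.JohnsonLeungKings2011.ClassGroupRow
  Summit.BirchSwinnertonDyer.BirchSwinnertonDyer.Theorems.SmallImageRttD2J1 Summit.BirchSwinnertonDyer.BirchSwinnertonDyer.Theorems.SmallImageRttD2Seq

variable {K : Type} [Field K] [NumberField K] {p : ℕ} [Fact p.Prime] (S : Set (PadicAlgCl p)) [FiniteDimensional ℚ_[p] (padicCoeffField S)]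
  (κ : ZpExtension K p) (θ' : absoluteGaloisGroup K →ₜ* (padicCoeffIntegers S)ˣ) (P : Set (HeightOneSpectrum (𝓞 K)))
  (M : Type) [AddCommGroup M] [DistribMulAction (absoluteGaloisGroup K) M] [TopologicalSpace M] [DiscreteTopology M]
  (hstab : ∀ m : M, IsOpen (MulAction.stabilizer (absoluteGaloisGroup K) m : Set (absoluteGaloisGroup K)))
  (B : ∀ k : ℕ, OMuCarrier K S (p ^ k) →+ ↥(torsionPow M p k) →+ MuCarrier K (p ^ k))
  (hB : ∀ (k : ℕ) (σ : absoluteGaloisGroup K) (x : OMuCarrier K S (p ^ k)) (m : ↥(torsionPow M p k)),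
    B k (muTwistO S θ' k σ x) (torsRep M hstab p k σ m) = mu K (p ^ k) σ (B k x m))
  (hPT : poitouTate_shaRestricted_tateDual_natural_at K P)
  [hFin : ∀ n : ℕ, Fintype (absoluteGaloisGroup K ⧸ κ.layerSubgroup n)]
  (hNP : ∀ n : ℕ, ramificationSubgroup K P ≤ κ.layerSubgroup n)
  (hμ : ∀ k : ℕ, ramificationSubgroup K P ≤ ContinuousRep.ker (muTwistO S θ' k))
  (hA : ∀ k : ℕ, ramificationSubgroup K P ≤ ContinuousRep.ker (torsRep M hstab p k))
  (hpP : ∀ v : HeightOneSpectrum (𝓞 K), ((p : ℕ) : 𝓞 K) ∈ v.asIdeal → v ∈ P)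

/-! ## §1 Identifying `e⁻¹` of a structure-mapped class -/

omit [FiniteDimensional ℚ_[p] (padicCoeffField S)] in
/-- **`e₂⁻¹ w = c` as soon as the transported `c` is `w`** (injectivity of the Ш-condition transport and of the Shapiro isomorphism, degree `2`).
[cite: MilneADT2006, I §4 (p. 56)] -/
theorem coe_eTwoO_symm_eq (n k : ℕ) (w : layerShaRestricted P (muTwistO S θ' k) (κ.layerSubgroup n) 2)
    (c : restrictedCohomology ((muTwistO S θ' k).coind (κ.layerSubgroup n) (κ.isOpen_layerSubgroup n)) P 2)
    (hc : haveI : (κ.layerSubgroup n).FiniteIndex := Subgroup.finiteIndex_of_finite_quotient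
      layerShapiroEquiv P (muTwistO S θ' k) (κ.layerSubgroup n) (κ.isOpen_layerSubgroup n) 2
        (restrictedCohomologyEquiv P (muTwistO S θ' k) (κ.layerSubgroup n) (κ.isOpen_layerSubgroup n) (hNP n) (hμ k) 2
          (c : restrictedCohomology ((muTwistO S θ' k).coindOpen (κ.layerSubgroup n) (κ.isOpen_layerSubgroup n)) P 2)) = w.1) :
    (((eTwoO S κ θ' P hNP hμ n k).symm w).1 : restrictedCohomology ((muTwistO S θ' k).coind (κ.layerSubgroup n) (κ.isOpen_layerSubgroup n)) P 2) = c := by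
  haveI : (κ.layerSubgroup n).FiniteIndex := Subgroup.finiteIndex_of_finite_quotient
  apply (restrictedCohomologyEquiv P (muTwistO S θ' k) (κ.layerSubgroup n) (κ.isOpen_layerSubgroup n) (hNP n) (hμ k) 2).injective
  apply (layerShapiroEquiv P (muTwistO S θ' k) (κ.layerSubgroup n) (κ.isOpen_layerSubgroup n) 2).injective
  refine Eq.trans ?_ hc.symm
  change (eTwoO S κ θ' P hNP hμ n k ((eTwoO S κ θ' P hNP hμ n k).symm w)).1 = _
  rw [AddEquiv.apply_symm_apply]

omit [FiniteDimensional ℚ_[p] (padicCoeffField S)] in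
/-- **`e₁⁻¹ w = c` as soon as the transported `c` is `w`** (degree `1`). [cite: MilneADT2006, I §4 (p. 56)] -/
theorem coe_eOneO_symm_eq (n k : ℕ) (w : layerShaRestricted P (torsRep M hstab p k) (κ.layerSubgroup n) 1)
    (c : restrictedCohomology (DiscreteGaloisModule.coind (torsRep M hstab p k) (κ.layerSubgroup n) (κ.isOpen_layerSubgroup n)) P 1)
    (hc : haveI : (κ.layerSubgroup n).FiniteIndex := Subgroup.finiteIndex_of_finite_quotient
      layerShapiroEquiv P (torsRep M hstab p k) (κ.layerSubgroup n) (κ.isOpen_layerSubgroup n) 1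
        (restrictedCohomologyEquiv P (torsRep M hstab p k) (κ.layerSubgroup n) (κ.isOpen_layerSubgroup n) (hNP n) (hA k) 1
          (c : restrictedCohomology ((torsRep M hstab p k).coindOpen (κ.layerSubgroup n) (κ.isOpen_layerSubgroup n)) P 1)) = w.1) :
    (((eOneO κ P M hstab hNP hA n k).symm w).1 : restrictedCohomology (DiscreteGaloisModule.coind (torsRep M hstab p k) (κ.layerSubgroup n) (κ.isOpen_layerSubgroup n)) P 1) = c := by
  haveI : (κ.layerSubgroup n).FiniteIndex := Subgroup.finiteIndex_of_finite_quotient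
  apply (restrictedCohomologyEquiv P (torsRep M hstab p k) (κ.layerSubgroup n) (κ.isOpen_layerSubgroup n) (hNP n) (hA k) 1).injective
  apply (layerShapiroEquiv P (torsRep M hstab p k) (κ.layerSubgroup n) (κ.isOpen_layerSubgroup n) 1).injective
  refine Eq.trans ?_ hc.symm
  change (eOneO κ P M hstab hNP hA n k ((eOneO κ P M hstab hNP hA n k).symm w)).1 = _
  rw [AddEquiv.apply_symm_apply]

omit [FiniteDimensional ℚ_[p] (padicCoeffField S)] in
/-- The transported class of `e₂⁻¹ w` is `w`. [cite: MilneADT2006, I §4 (p. 56)] -/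
theorem transport_eTwoO_symm (n k : ℕ) (w : layerShaRestricted P (muTwistO S θ' k) (κ.layerSubgroup n) 2) :
    haveI : (κ.layerSubgroup n).FiniteIndex := Subgroup.finiteIndex_of_finite_quotient
    layerShapiroEquiv P (muTwistO S θ' k) (κ.layerSubgroup n) (κ.isOpen_layerSubgroup n) 2
        (restrictedCohomologyEquiv P (muTwistO S θ' k) (κ.layerSubgroup n) (κ.isOpen_layerSubgroup n) (hNP n) (hμ k) 2
          ((((eTwoO S κ θ' P hNP hμ n k).symm w).1 : restrictedCohomology ((muTwistO S θ' k).coind (κ.layerSubgroup n) (κ.isOpen_layerSubgroup n)) P 2) :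
            restrictedCohomology ((muTwistO S θ' k).coindOpen (κ.layerSubgroup n) (κ.isOpen_layerSubgroup n)) P 2)) = w.1 := by
  change (eTwoO S κ θ' P hNP hμ n k ((eTwoO S κ θ' P hNP hμ n k).symm w)).1 = _
  rw [AddEquiv.apply_symm_apply]

omit [FiniteDimensional ℚ_[p] (padicCoeffField S)] in
/-- The transported class of `e₁⁻¹ w` is `w`. [cite: MilneADT2006, I §4 (p. 56)] -/
theorem transport_eOneO_symm (n k : ℕ) (w : layerShaRestricted P (torsRep M hstab p k) (κ.layerSubgroup n) 1) :
    haveI : (κ.layerSubgroup n).FiniteIndex := Subgroup.finiteIndex_of_finite_quotient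
    layerShapiroEquiv P (torsRep M hstab p k) (κ.layerSubgroup n) (κ.isOpen_layerSubgroup n) 1
        (restrictedCohomologyEquiv P (torsRep M hstab p k) (κ.layerSubgroup n) (κ.isOpen_layerSubgroup n) (hNP n) (hA k) 1
          ((((eOneO κ P M hstab hNP hA n k).symm w).1 : restrictedCohomology (DiscreteGaloisModule.coind (torsRep M hstab p k) (κ.layerSubgroup n) (κ.isOpen_layerSubgroup n)) P 1) :
            restrictedCohomology ((torsRep M hstab p k).coindOpen (κ.layerSubgroup n) (κ.isOpen_layerSubgroup n)) P 1)) = w.1 := by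
  change (eOneO κ P M hstab hNP hA n k ((eOneO κ P M hstab hNP hA n k).symm w)).1 = _
  rw [AddEquiv.apply_symm_apply]

/-! ## §2 Corestriction ⊣ restriction -/

include hpP in
/-- ★ **`⟨cor_{K_{n+1}/K_n} y, z⟩_n = ⟨y, res_{K_{n+1}/K_n} z⟩_{n+1}`**: clause (N_V) at the adjoint pair (fibre sum `coindFinSum`, pull-back `coindFinRes`)
(`sum_pairing_coindFinRes_eq_sum_coindFinSum`), transported by (S-cor) on `H²` (`layerShapiroEquiv_transport_coindFinSum` + `relCoresO_eq_relCor`) and (S-res) on `H¹`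
(`layerShapiroEquiv_transport_coindFinRes`). [cite: MilneADT2006, I §4 p. 65] [cite: NeukirchSchmidtWingberg2008, I §5 Prop. (1.5.3)(iv)] [cite: JohnsonLeungKings2011, §5.4 Lemma 5.8] -/
theorem pairO_cores (n k : ℕ) (hperf : Bijective fun m : ↥(torsionPow M p k) ↦ (B k).flip m) (y : cycLayerCohO S κ θ' P (n + 1) k 2)
    (hy : y ∈ layerShaRestricted P (muTwistO S θ' k) (κ.layerSubgroup (n + 1)) 2) (z : layerShaRestricted P (torsRep M hstab p k) (κ.layerSubgroup n) 1) :
    pairO S κ θ' P M hstab B hB hPT hNP hμ hA n k ⟨cycLayerCoresO S κ θ' P n k 2 y, cycLayerCoresO_mem_layerShaRestricted S κ θ' P hNP hμ n k hy⟩ z =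
      pairO S κ θ' P M hstab B hB hPT hNP hμ hA (n + 1) k ⟨y, hy⟩ (resYO κ P M hstab hNP hA n k z) := by
  haveI : (κ.layerSubgroup n).FiniteIndex := Subgroup.finiteIndex_of_finite_quotient
  haveI : (κ.layerSubgroup (n + 1)).FiniteIndex := Subgroup.finiteIndex_of_finite_quotient
  haveI : NeZero (p ^ k) := ⟨pow_ne_zero k (Fact.out : p.Prime).ne_zero⟩
  haveI := finite_oMuCarrier (K := K) S k
  have h' : κ.layerSubgroup (n + 1) ≤ κ.layerSubgroup n := κ.layerSubgroup_antitone (Nat.le_succ n)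
  simp only [pairO_apply]
  have hN := (Classical.choose_spec (exists_shaRestricted_pairing_coind_of_natural_at P hPT)).2
  refine @hN (p ^ k) _ (OMuCarrier K S (p ^ k)) (↥(torsionPow M p k)) (_) (_) _ _ (_) (_) _ (muTwistO S θ' k) (torsRep M hstab p k) (B k) (hB k)
    (κ.layerSubgroup (n + 1)) (hFin (n + 1)) (κ.isOpen_layerSubgroup (n + 1))
    (p ^ k) _ (OMuCarrier K S (p ^ k)) (↥(torsionPow M p k)) (_) (_) _ _ (_) (_) _ (muTwistO S θ' k) (torsRep M hstab p k) (B k) (hB k)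
    (κ.layerSubgroup n) (hFin n) (κ.isOpen_layerSubgroup n)
    hperf (oMuCarrier_torsion S k) (isUnramifiedOutside_muTwistO_coind S κ θ' P hNP hμ (n + 1) k) (mem_of_natCard_oMuCarrier_mem S P hpP k)
    (oMuCarrier_torsion S k) (isUnramifiedOutside_muTwistO_coind S κ θ' P hNP hμ n k) (mem_of_natCard_oMuCarrier_mem S P hpP k)
    (coindFinSum (muTwistO S θ' k).toTopRep h') (coindFinRes (torsRep M hstab p k).toTopRep h') ?_
    ((eTwoO S κ θ' P hNP hμ (n + 1) k).symm ⟨y, hy⟩)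
    ((eTwoO S κ θ' P hNP hμ n k).symm ⟨cycLayerCoresO S κ θ' P n k 2 y, cycLayerCoresO_mem_layerShaRestricted S κ θ' P hNP hμ n k hy⟩) ?_
    ((eOneO κ P M hstab hNP hA n k).symm z) ((eOneO κ P M hstab hNP hA (n + 1) k).symm (resYO κ P M hstab hNP hA n k z)) ?_
  · -- (hadj) trace ⊣ pull-back for the summed pairing
    intro φ ψ
    classical
    refine congrArg (fun s : MuCarrier K (p ^ k) ↦ ((Additive.toMul s : rootsOfUnity (p ^ k) (AlgebraicClosure K)) : (AlgebraicClosure K)ˣ)) ?_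
    exact sum_pairing_coindFinRes_eq_sum_coindFinSum h' (B k) φ ψ
  · -- (x) `e₂⁻¹ (cor y) = Σ_* (e₂⁻¹ y)`: (S-cor)
    refine coe_eTwoO_symm_eq S κ θ' P hNP hμ n k _ _ ?_
    haveI : ((κ.layerSubgroup (n + 1)).map (toUnramifiedQuot K P)).FiniteIndex := finiteIndex_imGS' P (κ.isOpen_layerSubgroup (n + 1))
    letI : Fintype (GaloisGroupUnramifiedOutside K P ⧸ (κ.layerSubgroup (n + 1)).map (toUnramifiedQuot K P)) := Fintype.ofFinite _
    haveI : (((κ.layerSubgroup (n + 1)).map (toUnramifiedQuot K P)).subgroupOf ((κ.layerSubgroup n).map (toUnramifiedQuot K P))).FiniteIndex := by infer_instance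
    letI : Fintype (↥((κ.layerSubgroup n).map (toUnramifiedQuot K P)) ⧸
        ((κ.layerSubgroup (n + 1)).map (toUnramifiedQuot K P)).subgroupOf ((κ.layerSubgroup n).map (toUnramifiedQuot K P))) := Fintype.ofFinite _
    refine (layerShapiroEquiv_transport_coindFinSum P (muTwistO S θ' k) (κ.layerSubgroup n) (κ.layerSubgroup (n + 1)) (κ.isOpen_layerSubgroup n)
      (κ.isOpen_layerSubgroup (n + 1)) h' (hNP n) (hNP (n + 1)) (hμ k) 2 _).trans ?_
    rw [transport_eTwoO_symm]
    change _ = cycLayerCoresO S κ θ' P n k 2 y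
    rw [cycLayerCoresO, relCoresO_eq_relCor]
    rfl
  · -- (z) `e₁⁻¹ (res z) = π^* (e₁⁻¹ z)`: (S-res)
    refine coe_eOneO_symm_eq κ P M hstab hNP hA (n + 1) k _ _ ?_
    refine (layerShapiroEquiv_transport_coindFinRes P (torsRep M hstab p k) (κ.layerSubgroup n) (κ.layerSubgroup (n + 1)) (κ.isOpen_layerSubgroup n)
      (κ.isOpen_layerSubgroup (n + 1)) h' (hNP n) (hNP (n + 1)) (hA k) 1 _).trans ?_
    rw [transport_eOneO_symm]
    exact (coe_resYO κ P M hstab hNP hA n k z).symm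

/-! ## §3 Reduction ⊣ inclusion -/

include hpP in
/-- ★ **`⟨red y, z⟩_k = ⟨y, incl z⟩_{k+1}`**: clause (N_V) at the adjoint pair (`red = coindFinMap muTwistORedHom`, `incl = coindFinMap torsInclHom`), the adjointness in `K̄ˣ`
being the displayed level law `hBred` of the pairings; transported by (S-coeff) (`layerShapiroEquiv_transport_coindFinMap`, `cohomologyMap_muTwistORedHom_eq_cycLayerRedO`).
[cite: MilneADT2006, I §4 p. 65] [cite: Kato2004Asterisque, §8.2 (p. 180)] [cite: JohnsonLeungKings2011, §5.4 Lemma 5.8] -/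
theorem pairO_red (n k : ℕ) (hperf : Bijective fun m : ↥(torsionPow M p k) ↦ (B k).flip m)
    (hBred : ∀ (x : OMuCarrier K S (p ^ (k + 1))) (m : ↥(torsionPow M p k)),
      muVal K (p ^ k) (B k (oMuRed S k x) m) = muVal K (p ^ (k + 1)) (B (k + 1) x (AddSubgroup.inclusion (torsionPow_mono (M := M) (p := p) (Nat.le_succ k)) m)))
    (y : cycLayerCohO S κ θ' P n (k + 1) 2) (hy : y ∈ layerShaRestricted P (muTwistO S θ' (k + 1)) (κ.layerSubgroup n) 2)
    (z : layerShaRestricted P (torsRep M hstab p k) (κ.layerSubgroup n) 1) :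
    pairO S κ θ' P M hstab B hB hPT hNP hμ hA n k ⟨cycLayerRedO S κ θ' P n k 2 y, cycLayerRedO_mem_layerShaRestricted S κ θ' P hNP hμ n k hy⟩ z =
      pairO S κ θ' P M hstab B hB hPT hNP hμ hA n (k + 1) ⟨y, hy⟩ (inclYO κ P M hstab hNP hA n k z) := by
  haveI : (κ.layerSubgroup n).FiniteIndex := Subgroup.finiteIndex_of_finite_quotient
  haveI : NeZero (p ^ k) := ⟨pow_ne_zero k (Fact.out : p.Prime).ne_zero⟩
  haveI : NeZero (p ^ (k + 1)) := ⟨pow_ne_zero (k + 1) (Fact.out : p.Prime).ne_zero⟩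
  haveI := finite_oMuCarrier (K := K) S k
  haveI := finite_oMuCarrier (K := K) S (k + 1)
  simp only [pairO_apply]
  have hN := (Classical.choose_spec (exists_shaRestricted_pairing_coind_of_natural_at P hPT)).2
  refine @hN (p ^ (k + 1)) _ (OMuCarrier K S (p ^ (k + 1))) (↥(torsionPow M p (k + 1))) (_) (_) _ _ (_) (_) _ (muTwistO S θ' (k + 1)) (torsRep M hstab p (k + 1))
    (B (k + 1)) (hB (k + 1)) (κ.layerSubgroup n) (hFin n) (κ.isOpen_layerSubgroup n)
    (p ^ k) _ (OMuCarrier K S (p ^ k)) (↥(torsionPow M p k)) (_) (_) _ _ (_) (_) _ (muTwistO S θ' k) (torsRep M hstab p k) (B k) (hB k)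
    (κ.layerSubgroup n) (hFin n) (κ.isOpen_layerSubgroup n)
    hperf (oMuCarrier_torsion S (k + 1)) (isUnramifiedOutside_muTwistO_coind S κ θ' P hNP hμ n (k + 1)) (mem_of_natCard_oMuCarrier_mem S P hpP (k + 1))
    (oMuCarrier_torsion S k) (isUnramifiedOutside_muTwistO_coind S κ θ' P hNP hμ n k) (mem_of_natCard_oMuCarrier_mem S P hpP k)
    (coindFinMap (muTwistORedHom S θ' k) (κ.layerSubgroup n)) (coindFinMap (torsInclHom M hstab (p := p) (Nat.le_succ k)) (κ.layerSubgroup n)) ?_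
    ((eTwoO S κ θ' P hNP hμ n (k + 1)).symm ⟨y, hy⟩)
    ((eTwoO S κ θ' P hNP hμ n k).symm ⟨cycLayerRedO S κ θ' P n k 2 y, cycLayerRedO_mem_layerShaRestricted S κ θ' P hNP hμ n k hy⟩) ?_
    ((eOneO κ P M hstab hNP hA n k).symm z) ((eOneO κ P M hstab hNP hA n (k + 1)).symm (inclYO κ P M hstab hNP hA n k z)) ?_
  · -- (hadj) `red` ⊣ `incl`, in `K̄ˣ` (termwise the level law `hBred`)
    intro φ ψ
    show muVal K (p ^ (k + 1)) (∑ y, B (k + 1) (φ y) ((coindFinMap (torsInclHom M hstab (p := p) (Nat.le_succ k)) (κ.layerSubgroup n)).hom ψ y)) =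
      muVal K (p ^ k) (∑ y, B k ((coindFinMap (muTwistORedHom S θ' k) (κ.layerSubgroup n)).hom φ y) (ψ y))
    rw [muVal_sum, muVal_sum]
    exact Finset.prod_congr rfl fun y _ ↦ (hBred (φ y) (ψ y)).symm
  · -- (x) `e₂⁻¹ (red y) = red_* (e₂⁻¹ y)`: (S-coeff) on `H²`
    refine coe_eTwoO_symm_eq S κ θ' P hNP hμ n k _ _ ?_
    refine (layerShapiroEquiv_transport_coindFinMap P (muTwistO S θ' (k + 1)) (muTwistO S θ' k) (κ.layerSubgroup n) (κ.isOpen_layerSubgroup n) (hNP n)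
      (hμ (k + 1)) (hμ k) (muTwistORedHom S θ' k) 2 _).trans ?_
    rw [transport_eTwoO_symm]
    exact cohomologyMap_muTwistORedHom_eq_cycLayerRedO S κ θ' P n k 2 y
  · -- (z) `e₁⁻¹ (incl z) = incl_* (e₁⁻¹ z)`: (S-coeff) on `H¹`
    refine coe_eOneO_symm_eq κ P M hstab hNP hA n (k + 1) _ _ ?_
    refine (layerShapiroEquiv_transport_coindFinMap P (torsRep M hstab p k) (torsRep M hstab p (k + 1)) (κ.layerSubgroup n) (κ.isOpen_layerSubgroup n) (hNP n)
      (hA k) (hA (k + 1)) (torsInclHom M hstab (p := p) (Nat.le_succ k)) 1 _).trans ?_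
    rw [transport_eOneO_symm]
    exact (coe_inclYO κ P M hstab hNP hA n k z).symm

/-! ## §4 `conj_γ ⊣ conj_{γ⁻¹}` -/

include hpP in
/-- ★ **`⟨conj_γ y, z⟩ = ⟨y, conj_{γ⁻¹} z⟩`**: clause (N_V) at the adjoint pair of right translations (`R_{γU} ⊣ R_{γ⁻¹U}`, `sum_pairing_rTrans`), transported by (S-conj)
(`layerShapiroEquiv_transport_rTransHom_two/_one`; honda's `cycLayerConjO … γ = ShaLayer.layerConj … (π γ)`). [cite: MilneADT2006, I §4 p. 65] [cite: SerreLocalFields1979, VII §5]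
[cite: JohnsonLeungKings2011, §4.2, §5.4 Lemma 5.8] -/
theorem pairO_conj (n k : ℕ) (hperf : Bijective fun m : ↥(torsionPow M p k) ↦ (B k).flip m) (γ : absoluteGaloisGroup K) (y : cycLayerCohO S κ θ' P n k 2)
    (hy : y ∈ layerShaRestricted P (muTwistO S θ' k) (κ.layerSubgroup n) 2) (z : layerShaRestricted P (torsRep M hstab p k) (κ.layerSubgroup n) 1) :
    pairO S κ θ' P M hstab B hB hPT hNP hμ hA n k ⟨cycLayerConjO S κ θ' P n k 2 γ y, cycLayerConjO_mem_layerShaRestricted S κ θ' P n k γ hy⟩ z =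
      pairO S κ θ' P M hstab B hB hPT hNP hμ hA n k ⟨y, hy⟩ (conjYO κ P M hstab n k γ⁻¹ z) := by
  haveI : (κ.layerSubgroup n).FiniteIndex := Subgroup.finiteIndex_of_finite_quotient
  haveI : NeZero (p ^ k) := ⟨pow_ne_zero k (Fact.out : p.Prime).ne_zero⟩
  haveI := finite_oMuCarrier (K := K) S k
  simp only [pairO_apply]
  have hN := (Classical.choose_spec (exists_shaRestricted_pairing_coind_of_natural_at P hPT)).2
  refine @hN (p ^ k) _ (OMuCarrier K S (p ^ k)) (↥(torsionPow M p k)) (_) (_) _ _ (_) (_) _ (muTwistO S θ' k) (torsRep M hstab p k) (B k) (hB k)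
    (κ.layerSubgroup n) (hFin n) (κ.isOpen_layerSubgroup n)
    (p ^ k) _ (OMuCarrier K S (p ^ k)) (↥(torsionPow M p k)) (_) (_) _ _ (_) (_) _ (muTwistO S θ' k) (torsRep M hstab p k) (B k) (hB k)
    (κ.layerSubgroup n) (hFin n) (κ.isOpen_layerSubgroup n)
    hperf (oMuCarrier_torsion S k) (isUnramifiedOutside_muTwistO_coind S κ θ' P hNP hμ n k) (mem_of_natCard_oMuCarrier_mem S P hpP k)
    (oMuCarrier_torsion S k) (isUnramifiedOutside_muTwistO_coind S κ θ' P hNP hμ n k) (mem_of_natCard_oMuCarrier_mem S P hpP k)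
    ((muTwistO S θ' k).coindOpenRTrans (κ.layerSubgroup n) (κ.isOpen_layerSubgroup n) (QuotientGroup.mk γ : absoluteGaloisGroup K ⧸ κ.layerSubgroup n))
    ((torsRep M hstab p k).coindOpenRTrans (κ.layerSubgroup n) (κ.isOpen_layerSubgroup n)
      (QuotientGroup.mk γ⁻¹ : absoluteGaloisGroup K ⧸ κ.layerSubgroup n)) ?_
    ((eTwoO S κ θ' P hNP hμ n k).symm ⟨y, hy⟩)
    ((eTwoO S κ θ' P hNP hμ n k).symm ⟨cycLayerConjO S κ θ' P n k 2 γ y, cycLayerConjO_mem_layerShaRestricted S κ θ' P n k γ hy⟩) ?_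
    ((eOneO κ P M hstab hNP hA n k).symm z) ((eOneO κ P M hstab hNP hA n k).symm (conjYO κ P M hstab n k γ⁻¹ z)) ?_
  · -- (hadj) `R_{γU}` ⊣ `R_{γ⁻¹U}`
    intro φ ψ
    refine congrArg (fun s : MuCarrier K (p ^ k) ↦ ((Additive.toMul s : rootsOfUnity (p ^ k) (AlgebraicClosure K)) : (AlgebraicClosure K)ˣ)) ?_
    rw [QuotientGroup.mk_inv]
    exact (sum_pairing_rTrans (B k) (QuotientGroup.mk γ : absoluteGaloisGroup K ⧸ κ.layerSubgroup n) φ ψ).symm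
  · -- (x) `e₂⁻¹ (conj_γ y) = R_{γU,*} (e₂⁻¹ y)`: (S-conj) on `H²`
    refine coe_eTwoO_symm_eq S κ θ' P hNP hμ n k _ _ ?_
    refine (layerShapiroEquiv_transport_rTransHom_two P (muTwistO S θ' k) (κ.layerSubgroup n) (κ.isOpen_layerSubgroup n) (hNP n) (hμ k) γ _).trans ?_
    rw [transport_eTwoO_symm]
    rfl
  · -- (z) `e₁⁻¹ (conj_{γ⁻¹} z) = R_{γ⁻¹U,*} (e₁⁻¹ z)`: (S-conj) on `H¹`
    refine coe_eOneO_symm_eq κ P M hstab hNP hA n k _ _ ?_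
    refine (layerShapiroEquiv_transport_rTransHom_one P (torsRep M hstab p k) (κ.layerSubgroup n) (κ.isOpen_layerSubgroup n) (hNP n) (hA k) γ⁻¹ _).trans ?_
    rw [transport_eOneO_symm]
    exact (coe_conjYO κ P M hstab n k γ⁻¹ z).symm

end Summit.BirchSwinnertonDyer.BirchSwinnertonDyer.Theorems.SmallImageRttJunctionSha

end
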